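import Summits.BirchSwinnertonDyer.BirchSwinnertonDyer.Theorems.RamifiedHeegnerPairLeafPartnerOrdersGorensteinCore
import Mathlib.LinearAlgebra.Quotient.Basic
import Mathlib.RingTheory.Ideal.Quotient.Operations
import Mathlib.RingTheory.Ideal.Maps
import HarnessLib

/-!
# Route `RamifiedHeegnerPair`, crux U₁ `LeafRankOneUpperAtThree` (stmt-BirchSwinnertonDyer-26022), line `partnerdescent` —
# partner kernel: the (G3♭ˢ) derivation ASSEMBLED as one local theorem — «congruence ideal = lattice denominator»

HONEST FRAMING. Theorems only; helper file (`--supports stmt-BirchSwinnertonDyer-26022 --as helper`); pure commutative algebra over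
Mathlib, no number theory, no named fact, no `sorry`; nothing booked; BSD is proved for no curve. Lead prover bsd-line-rhp-p2 g63, 2026-08-31.
Continues `…LeafPartnerOrdersDualLattice` ((F6a)–(F6c), g60) and `…LeafPartnerOrdersGorensteinCore` (Steps 1–3, g61).

WHY. The line's stub (G3♭ˢ) `Partnerdescent.stub_partnerCokernelThreeFreeFlatSplit` is DERIVATION-grade (LEAD-G56-G3-NONSCALAR.md §2,
LEAD-G61-G3-CORE.md §0). g61 landed the algebra of its three steps as SEPARATE bricks, leaving the assembly («Steps 1–3 assemble with no
further idea») unwritten. This file writes it, in Mathlib generality, as ONE implication whose hypotheses are exactly the shapes the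
arithmetic inputs must be typed in, and in doing so CUTS one input: Step 2 no longer needs Ribet's exact sequence with its degeneracy
maps (input (C2) = (P1)), only that the character lattice `Y = X_r(J′)` is a Hecke-stable sublattice of `B = X_q(J_0(qrM))` cut out by
its own annihilator, `Y = B[Ann_T Y]` — which holds as soon as `Y` is saturated and some Hecke operator acts on `Y` as a non-zero scalar
`N₀` while mapping `B` into `Y` (`N₀·e_new ∈ 𝕋`: the new/old projector has a Hecke denominator; Jacquet–Langlands + strong multiplicity one).

THE THEOREM (`smul_sub_mem_annihilator_iff_forall_smul_mem`). Let `T` be a commutative `O`-algebra, `B = T·b` a cyclic faithful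
`T`-module (free of rank one: Step 1a, multiplicity one + Nakayama) carrying a PERFECT `T`-invariant `O`-bilinear pairing `β` (Step 1b:
`T` is then Gorenstein; in the derivation `β` = Gross's pairing on `X_q(J_0(qrM))_𝔪`, perfect at non-Eisenstein `𝔪` by the landed exact
Eisenstein property, FPE p806900), `Y ≤ B` a `T`-submodule with `B[Ann_T Y] ⊆ Y`, and suppose `𝕋′ := T ⧸ Ann_T Y` (the quotient acting
faithfully on `Y`) is finite free over `O`. Then for every `t ∈ T` and scalars `N, a ∈ O`:

  `a·t̄ ∈ N·𝕋′` (i.e. `a·t − N·y₀ ∈ Ann_T Y` for some `y₀ ∈ T`)   ⟺   `(a·t)·Y ⊆ N·Y`.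

Read with `t = N·e_f` (`N·e_f ∈ 𝕋`, the `f`-projector's Hecke denominator): the left side says `a·e_f ∈ 𝕋′_𝔪`, i.e. `a` lies in the
CONGRUENCE IDEAL `(η′_f)` of `f` in the `qr`-new algebra `𝕋′_𝔪`; the right side says `a·e_f` preserves the lattice `Y = X_r(J′)_𝔪`, i.e.
`R ∣ a` with `R = ξ/i` the denominator of `e_f` on `X_r(J′)` (`LeafPartnerOrders.forall_dvd_mul_pairing_iff`, p801913). Hence
`(η′_f) = (R)` as ideals of `O = ℤ₃`: Papikian–Rabinoff's `s = r` (Lemma 32) in the tree's coordinates. With `δ_{qr,M} ∣ η′_f` (the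
JL-degree divides the new congruence number: PR ¶23 + Lemma 24, the ONE geometric input (C5)) and `δ = R·j` (Takahashi Thm. 2.3,
`not_dvd_iff_padicValNat_eq`), `ord₃ δ = ord₃ R`, i.e. `3 ∤ j = cJ P r` — the stub.

CONTENTS (all sorry-free, Mathlib generality):
* `exists_smul_eq_of_forall_dual_dvd` — Step 3, scalar-free form: in a finite free `O`-module, a vector on which EVERY functional is
  divisible by `N` is divisible by `N` (dual basis). Replaces the `K ⊗ R` phrasing of `exists_tmul_eq_iff_forall_dual_mul_tmul`.
* `exists_sub_smul_mem_of_forall_dual_dvd` — the same for a quotient `T ⧸ J` finite free over `O`, phrased on `T`: if every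
  `O`-functional of `T` vanishing on `J` is divisible by `N` on `v`, then `v ∈ N·T + J`.
* `mem_of_forall_annihilator_smul_eq_zero` — `B[Ann_T Y] ⊆ Y` from saturation and a projector with denominator (`N₀·e_Y ∈ T`).
* `smul_mem_iff_mem_annihilator_annihilator` — for `B = T·b` faithful and `B[Ann_T Y] ⊆ Y`: `a·b ∈ Y ⟺ a ∈ Ann_T(Ann_T Y)` — the
  hypothesis `hIJ` of `exists_dualAnnihilator_transport` with `J = Ann_T Y`, WITHOUT (F6c)'s new × old embedding or degeneracy maps.
* `forall_smul_mem_of_smul_sub_mem_annihilator` — «⟹» of the theorem (elementary).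
* `exists_smul_sub_mem_of_forall_smul_mem` — «⟸» from ANY `T`-equivariant `O`-linear map `Φ : Y → T^∨` hitting every functional that
  vanishes on `J` (injectivity is not needed) plus the separation property of `T ⧸ J`.
* `smul_sub_mem_annihilator_iff_forall_smul_mem` — the assembled theorem (Steps 1b + 2 + 3).
* `dvd_and_dvd_of_congruence_iff_lattice` — the numerical end: congruence side ⟺ lattice side, lattice side ⟺ `R ∣ a`,
  congruence side ⟹ `δ ∣ a`, `R ∣ δ` ⟹ `δ` and `R` associated (`ord₃ δ = ord₃ R`, `3 ∤ j`).
* `bijective_of_forall_exists_eq_comp` — the perfectness input in usable form: an injective pairing map `β : B → B^∨` such that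
  `φ ∘ u ∈ β(B)` for every functional `φ` and ONE invertible `u` (exact Eisenstein `(T_ℓ − ℓ − 1)·B^∨ ⊆ B` with `T_ℓ − ℓ − 1 ∉ 𝔪`,
  a unit of `T_𝔪`) is bijective.

Nothing here is specific to `3`, Hecke algebras or Shimura curves; the dictionary to the derivation is in the docstrings and in the memo
`Cruxes/LeafRankOneUpperAtThree/LEAD-G63-ASSEMBLY.md`. [cite: BourbakiAlgebraI1989, Ch. II §2 no. 6 (dual basis), Ch. II §1 no. 11 (annihilators)]
[cite: Matsumura1987, §18 Thm. 18.1 (Gorenstein duality)] [cite: PapikianRabinoff2016, §3 ¶23–¶25, Lemma 24, Lemma 32 (arXiv:1212.3574 pp. 8–9)]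
-/

set_option linter.dupNamespace false
set_option autoImplicit false

noncomputable section

namespace Summit.BirchSwinnertonDyer.BirchSwinnertonDyer.Theorems.LeafPartnerOrders

/-! ## Step 3, scalar-free: divisibility is detected by functionals -/

section DualDivisibility

variable {O : Type*} [CommRing O] {R : Type*} [AddCommGroup R] [Module O R] [Module.Free O R] [Module.Finite O R]

/-- **Divisibility by `N` is detected by the dual** (dual-basis argument). In a finite free `O`-module `R`, if every `O`-linear
functional takes on `v` a value divisible by `N`, then `v = N·w` for some `w`. This is Step 3 of the (G3♭ˢ) derivation
(`Stab(ω_R) = R`, Papikian–Rabinoff Lemma 32) in scalar-free form: applied to `R = 𝕋′_𝔪` and `v = a·(N e_f)` it says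
`a·e_f ∈ 𝕋′_𝔪` as soon as `a·e_f` preserves `ω_{𝕋′_𝔪}`. [cite: BourbakiAlgebraI1989, Ch. II §2 no. 6 (dual basis)] -/
theorem exists_smul_eq_of_forall_dual_dvd (N : O) (v : R) (h : ∀ φ : Module.Dual O R, N ∣ φ v) :
    ∃ w : R, N • w = v := by
  classical
  let b := Module.Free.chooseBasis O R
  choose c hc using fun i ↦ h (b.coord i)
  refine ⟨∑ i, c i • b i, ?_⟩
  rw [Finset.smul_sum]
  conv_rhs => rw [← b.sum_repr v]
  refine Finset.sum_congr rfl fun i _ ↦ ?_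
  rw [smul_smul, ← hc i, Module.Basis.coord_apply]

end DualDivisibility

section QuotientSeparation

variable {O : Type*} [CommRing O] {T : Type*} [CommRing T] [Algebra O T]

/-- **The same for a quotient algebra, read on `T`.** If `T ⧸ J` is finite free over `O` and every `O`-functional of `T` that
vanishes on `J` takes on `v` a value divisible by `N`, then `v ∈ N·T + J`. (Functionals of `T ⧸ J` pull back to functionals of `T`
vanishing on `J`.) In the derivation: `T = 𝕋_𝔪` (Hecke algebra of `X_q(J_0(qrM))_𝔪`), `J = Ann(X_r(J′)_𝔪)`, `T ⧸ J = 𝕋′_𝔪` the `qr`-new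
quotient, a finite free `ℤ₃`-module. [cite: BourbakiAlgebraI1989, Ch. II §2 no. 6] -/
theorem exists_sub_smul_mem_of_forall_dual_dvd (J : Ideal T) [Module.Free O (T ⧸ J)] [Module.Finite O (T ⧸ J)]
    (N : O) (v : T) (h : ∀ ψ : Module.Dual O T, (∀ j ∈ J, ψ j = 0) → N ∣ ψ v) :
    ∃ y : T, v - N • y ∈ J := by
  let π : T →ₗ[O] T ⧸ J := (Ideal.Quotient.mkₐ O J).toLinearMap
  have hπ : ∀ x : T, π x = Ideal.Quotient.mk J x := fun x ↦ rfl
  have hv : ∀ φ : Module.Dual O (T ⧸ J), N ∣ φ (π v) := by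
    intro φ
    refine h (φ ∘ₗ π) fun j hj ↦ ?_
    rw [LinearMap.comp_apply, hπ, Ideal.Quotient.eq_zero_iff_mem.mpr hj, map_zero]
  obtain ⟨w, hw⟩ := exists_smul_eq_of_forall_dual_dvd N (π v) hv
  obtain ⟨y, hy⟩ := Ideal.Quotient.mk_surjective w
  refine ⟨y, ?_⟩
  rw [← Ideal.Quotient.eq_zero_iff_mem, map_sub, ← hπ, ← hπ, map_smul, hπ y, hy, hw, sub_self]

end QuotientSeparation

/-! ## `Y = B[Ann_T Y]`: from saturation and a projector with a Hecke denominator; the hypothesis `hIJ` of Step 2 -/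

section Annihilator

variable {T : Type*} [CommRing T] {B : Type*} [AddCommGroup B] [Module T B]

/-- **`B[Ann_T Y] ⊆ Y` from saturation and a projector.** If some `u ∈ T` acts on the `T`-submodule `Y` as the scalar `N₀` and maps
all of `B` into `Y`, and `Y` is `N₀`-saturated in `B`, then every `x ∈ B` killed by `Ann_T(Y)` lies in `Y` (`u − N₀ ∈ Ann_T Y`, so
`N₀ x = u x ∈ Y`). In the derivation: `B = X_q(J_0(qrM))`, `Y = X_r(J^{qr}_0(M))` (a saturated Hecke-stable sublattice under Ribet's
embedding), `u = N₀·e_new ∈ 𝕋` a Hecke multiple of the projector onto the `qr`-new part (Jacquet–Langlands and strong multiplicity one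
separate the `qr`-new from the `r`-old eigensystems). This replaces Ribet's exact sequence / degeneracy maps in Step 2.
[cite: BourbakiAlgebraI1989, Ch. II §1 no. 11 (annihilators)] -/
theorem mem_of_forall_annihilator_smul_eq_zero (Y : Submodule T B) (u N₀ : T)
    (hu : ∀ y ∈ Y, u • y = N₀ • y) (huB : ∀ x : B, u • x ∈ Y) (hsat : ∀ x : B, N₀ • x ∈ Y → x ∈ Y)
    (x : B) (hx : ∀ j ∈ Y.annihilator, j • x = 0) : x ∈ Y := by
  have hmem : u - N₀ ∈ Y.annihilator := by
    rw [Submodule.mem_annihilator]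
    intro y hy
    rw [sub_smul, hu y hy, sub_self]
  have h0 : (u - N₀) • x = 0 := hx _ hmem
  rw [sub_smul, sub_eq_zero] at h0
  exact hsat x (h0 ▸ huB x)

/-- **The hypothesis `hIJ` of `exists_dualAnnihilator_transport`, with `J = Ann_T Y`.** For `B = T·b` with `b` faithful and a
`T`-submodule `Y` with `B[Ann_T Y] ⊆ Y`: `a·b ∈ Y ⟺ a ∈ Ann_T(Ann_T Y)`. So Step 2 runs with `J := Ann_T(Y)` — the ideal for which
`T ⧸ J` is the algebra acting faithfully on `Y` — and needs neither (F6c)'s `new × old` embedding nor degeneracy maps.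
[cite: BourbakiAlgebraI1989, Ch. II §1 no. 11] -/
theorem smul_mem_iff_mem_annihilator_annihilator (b : B) (hfaith : ∀ t : T, t • b = 0 → t = 0) (Y : Submodule T B)
    (hBY : ∀ x : B, (∀ j ∈ Y.annihilator, j • x = 0) → x ∈ Y) (a : T) :
    a • b ∈ Y ↔ a ∈ (Y.annihilator : Submodule T T).annihilator := by
  rw [Submodule.mem_annihilator]
  constructor
  · intro h j hj
    have h0 : j • (a • b) = 0 := (Submodule.mem_annihilator.mp hj) _ h
    rw [smul_smul] at h0
    rw [smul_eq_mul, mul_comm]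
    exact hfaith _ h0
  · intro h
    refine hBY _ fun j hj ↦ ?_
    rw [smul_smul, mul_comm, ← smul_eq_mul, h j hj, zero_smul]

end Annihilator

/-! ## The two inclusions between the congruence side `a·t̄ ∈ N·(T ⧸ J)` and the lattice side `(a·t)·Y ⊆ N·Y` -/

section Denominators

variable {O : Type*} [CommRing O] {T : Type*} [CommRing T] [Algebra O T]
  {B : Type*} [AddCommGroup B] [Module O B] [Module T B] [IsScalarTower O T B]

/-- **«⟹» (elementary).** If `a·t − N·y₀` annihilates `Y` for some `y₀ ∈ T`, then `(a·t)·y = N·(y₀·y) ∈ N·Y` for every `y ∈ Y`.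
(Papikian–Rabinoff: an element of `𝕋′` preserves the lattice `Λ`; «`r ∣ s`».) [cite: PapikianRabinoff2016, §3 ¶23] -/
theorem forall_smul_mem_of_smul_sub_mem_annihilator (Y : Submodule T B) (t : T) (N a : O) (y₀ : T)
    (h : a • t - N • y₀ ∈ Y.annihilator) : ∀ y ∈ Y, ∃ y' ∈ Y, (a • t) • y = N • y' := by
  intro y hy
  refine ⟨y₀ • y, Y.smul_mem y₀ hy, ?_⟩
  have h0 : (a • t - N • y₀) • y = 0 := (Submodule.mem_annihilator.mp h) y hy
  rw [sub_smul, sub_eq_zero] at h0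
  rw [h0, smul_assoc]

/-- **«⟸» from an equivariant map onto the functionals vanishing on `J`.** Let `Φ : Y → T^∨ = Hom_O(T, O)` be `O`-linear and
`T`-EQUIVARIANT (`Φ(s·y) = Φ(y)(s·)`) and hit every `O`-functional of `T` vanishing on the ideal `J` (Step 2 supplies such a `Φ`, even
injective with image exactly `J^⊥ = ω_{T/J}`; injectivity is not used here), and let `T ⧸ J` have the separation property «divisible by
`N` under all `J`-vanishing functionals ⟹ in `N·T + J`» (`exists_sub_smul_mem_of_forall_dual_dvd`). If `(a·t)·Y ⊆ N·Y` then
`a·t ∈ N·T + J`: for `ψ = Φ(y)`, `ψ(a t) = Φ((a t)·y)(1) = Φ(N y′)(1) = N·Φ(y′)(1)`. (Papikian–Rabinoff Lemma 32: a perfect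
equivariant pairing `𝕋 × Λ → ℤ` forces «`s ∣ r`».) [cite: PapikianRabinoff2016, Lemma 32 (arXiv:1212.3574 p. 9)] -/
theorem exists_smul_sub_mem_of_forall_smul_mem (Y : Submodule T B) (J : Ideal T)
    (Φ : Y →ₗ[O] Module.Dual O T)
    (hΦsurj : ∀ ψ : Module.Dual O T, (∀ j ∈ J, ψ j = 0) → ∃ y : Y, Φ y = ψ)
    (hΦeq : ∀ (s : T) (y : Y), Φ (s • y) = Φ y ∘ₗ LinearMap.mulLeft O s)
    (N : O) (hsep : ∀ v : T, (∀ ψ : Module.Dual O T, (∀ j ∈ J, ψ j = 0) → N ∣ ψ v) → ∃ y₀ : T, v - N • y₀ ∈ J)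
    (t : T) (a : O) (h : ∀ y ∈ Y, ∃ y' ∈ Y, (a • t) • y = N • y') :
    ∃ y₀ : T, a • t - N • y₀ ∈ J := by
  refine hsep (a • t) fun ψ hψ ↦ ?_
  obtain ⟨y, rfl⟩ := hΦsurj ψ hψ
  obtain ⟨y', hy', hyy'⟩ := h y y.2
  -- `Φ y (a t) = Φ ((a t) • y) 1 = Φ (N • y') 1 = N * Φ y' 1`
  have h1 : Φ y (a • t) = (Φ ((a • t) • y)) 1 := by
    rw [hΦeq, LinearMap.comp_apply, LinearMap.mulLeft_apply, mul_one]
  have h2 : (a • t) • y = N • (⟨y', hy'⟩ : Y) := by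
    apply Subtype.ext
    rw [Submodule.coe_smul, Submodule.coe_smul_of_tower, hyy']
  refine ⟨Φ ⟨y', hy'⟩ 1, ?_⟩
  rw [h1, h2, map_smul, LinearMap.smul_apply, smul_eq_mul]

end Denominators

/-! ## The assembled theorem: Steps 1b + 2 + 3 -/

section Assembly

variable {O : Type*} [CommRing O] {T : Type*} [CommRing T] [Algebra O T]
  {B : Type*} [AddCommGroup B] [Module O B] [Module T B] [IsScalarTower O T B]

/-- **Congruence ideal = lattice denominator** (the (G3♭ˢ) derivation as one theorem). Let `B = T·b` be cyclic and faithful over the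
commutative `O`-algebra `T` (free of rank one — Step 1a: multiplicity one at `𝔪` + Nakayama), `β` a PERFECT `T`-INVARIANT `O`-bilinear
pairing on `B` (Step 1b ⟹ `T` Gorenstein; Gross's pairing on `X_q(J_0(qrM))_𝔪`, perfect at non-Eisenstein `𝔪` by exact Eisenstein),
`Y ≤ B` a `T`-submodule with `B[Ann_T Y] ⊆ Y` (`mem_of_forall_annihilator_smul_eq_zero`: `X_r(J′)_𝔪`, saturated, cut out by the new
projector), and `T ⧸ Ann_T Y` finite free over `O` (`= 𝕋′_𝔪`, the `qr`-new Hecke algebra). Then for `t ∈ T`, `N, a ∈ O`: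
`a·t ∈ N·T + Ann_T Y` ⟺ `(a·t)·Y ⊆ N·Y`. With `t = N·e_f`: the congruence ideal of `f` in `𝕋′_𝔪` EQUALS the denominator ideal of
`e_f` on `X_r(J′)_𝔪` (`= (ξ/i)`, `forall_dvd_mul_pairing_iff`) — Papikian–Rabinoff's `s = r`. Proof: Step 1b
(`bijective_dual_mulLeft_of_invariant_pairing`) gives a perfect trace `λ`; Step 2 (`exists_dualAnnihilator_transport` with
`p = B → B/Y`, `J = Ann_T Y`, `hIJ` from `smul_mem_iff_mem_annihilator_annihilator`) gives `Y ≅ ω_{T/J}` equivariantly; Step 3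
(`exists_sub_smul_mem_of_forall_dual_dvd`) and the two inclusions above conclude. [cite: PapikianRabinoff2016, §3 ¶23–¶25, Lemma 32]
[cite: Matsumura1987, §18 Thm. 18.1] -/
theorem smul_sub_mem_annihilator_iff_forall_smul_mem (b : B) (hspan : Submodule.span T {b} = ⊤)
    (hfaith : ∀ t : T, t • b = 0 → t = 0) (β : B →ₗ[O] B →ₗ[O] O) (hperf : Function.Bijective β)
    (hinv : ∀ (t : T) (x y : B), β (t • x) y = β x (t • y))
    (Y : Submodule T B) (hBY : ∀ x : B, (∀ j ∈ Y.annihilator, j • x = 0) → x ∈ Y)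
    [Module.Free O (T ⧸ Y.annihilator)] [Module.Finite O (T ⧸ Y.annihilator)]
    (t : T) (N a : O) :
    (∃ y₀ : T, a • t - N • y₀ ∈ Y.annihilator) ↔ (∀ y ∈ Y, ∃ y' ∈ Y, (a • t) • y = N • y') := by
  refine ⟨fun ⟨y₀, hy₀⟩ ↦ forall_smul_mem_of_smul_sub_mem_annihilator Y t N a y₀ hy₀, fun h ↦ ?_⟩
  -- Step 1b: the perfect trace `λ(s) = β(b, s b)`
  let lam : Module.Dual O T := β b ∘ₗ (LinearMap.toSpanSingleton T B b).restrictScalars O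
  have hlam : Function.Bijective fun s : T ↦ lam ∘ₗ LinearMap.mulLeft O s :=
    bijective_dual_mulLeft_of_invariant_pairing b hspan hfaith β hperf hinv
  -- Step 2: transport of `Y = ker (B → B/Y)` onto the functionals vanishing on `J = Ann_T Y`
  set J : Ideal T := Y.annihilator with hJ
  have hIJ : ∀ s : T, Y.mkQ (s • b) = 0 ↔ s ∈ (J : Submodule T T).annihilator := by
    intro s
    rw [Submodule.mkQ_apply, Submodule.Quotient.mk_eq_zero]
    exact smul_mem_iff_mem_annihilator_annihilator b hfaith Y hBY s
  obtain ⟨Φ, -, -, hΦsurj, hΦeq⟩ := exists_dualAnnihilator_transport b hspan hfaith Y.mkQ lam hlam J hIJ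
  -- identify `ker (B → B/Y)` with `Y`
  let e : Y ≃ₗ[T] LinearMap.ker Y.mkQ := LinearEquiv.ofEq _ _ (Submodule.ker_mkQ Y).symm
  let Ψ : Y →ₗ[O] Module.Dual O T := Φ ∘ₗ e.toLinearMap.restrictScalars O
  have hΨ : ∀ y : Y, Ψ y = Φ (e y) := fun y ↦ rfl
  refine exists_smul_sub_mem_of_forall_smul_mem Y J Ψ ?_ ?_ N
    (fun v hv ↦ exists_sub_smul_mem_of_forall_dual_dvd J N v hv) t a h
  · intro ψ hψ
    obtain ⟨x, hx⟩ := hΦsurj ψ ((Submodule.mem_dualAnnihilator _).mpr fun j hj ↦ hψ j hj)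
    exact ⟨e.symm x, by rw [hΨ, LinearEquiv.apply_symm_apply, hx]⟩
  · intro s y
    rw [hΨ, hΨ, map_smul, hΦeq]

/-- **The numerical end of the derivation** (order theory only). If for the scalars `a ∈ O` the congruence side and the lattice
side agree (the theorem above), the lattice side is `R ∣ a` (the denominator of `e_f` on `X_r(J′)` is `R = ξ/i`:
`forall_dvd_mul_pairing_iff`), the congruence side implies `δ ∣ a` (the JL-degree divides the new congruence number: Papikian–Rabinoff
¶23 + Lemma 24, input (C5)), and `R ∣ δ` (Takahashi: `δ = R·j`), then `δ ∣ R` as well — so `δ` and `R` are associated, `ord₃ δ = ord₃ R`,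
`3 ∤ j`. [cite: PapikianRabinoff2016, §3 ¶23–¶25, Lemma 24, Lemma 32] [cite: Takahashi2001, Thm. 2.3] -/
theorem dvd_and_dvd_of_congruence_iff_lattice {Cong Latt : O → Prop} {R δ : O}
    (hiff : ∀ a, Cong a ↔ Latt a) (hlatt : ∀ a, Latt a ↔ R ∣ a) (hdeg : ∀ a, Cong a → δ ∣ a) (hRδ : R ∣ δ) :
    δ ∣ R ∧ R ∣ δ :=
  ⟨hdeg R ((hiff R).mpr ((hlatt R).mpr dvd_rfl)), hRδ⟩

end Assembly

/-! ## The perfectness input in usable form: exact Eisenstein with a unit -/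

section Perfect

variable {O : Type*} [CommRing O] {B : Type*} [AddCommGroup B] [Module O B]

/-- **Exact Eisenstein with a unit ⟹ perfect.** Let `β : B → B^∨` be injective (a non-degenerate pairing) and `u : B → B` an
INVERTIBLE `O`-linear map such that every functional composed with `u` is represented: `φ ∘ u ∈ β(B)` for all `φ ∈ B^∨`. Then `β` is
bijective (the pairing is perfect): `φ = (φ ∘ u⁻¹) ∘ u`. In the derivation: `B = X_q(J_0(qrM))_𝔪` with Gross's pairing,
`u = T_ℓ − ℓ − 1` for a prime `ℓ ∤ 3N` with `a_ℓ(f) ≢ ℓ + 1 (mod 3)` (exists: `ρ̄` irreducible), a unit of `𝕋_𝔪`; the hypothesis is the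
landed EXACT Eisenstein property `(T_ℓ − ℓ − 1)·B^∨ ⊆ B` (`LeafPartnerBrandt.exact_eisenstein`, p806900) localised at `𝔪`.
[cite: BourbakiAlgebraI1989, Ch. II §2 no. 6] -/
theorem bijective_of_forall_exists_eq_comp (β : B →ₗ[O] Module.Dual O B) (hinj : Function.Injective β)
    (u : B →ₗ[O] B) (hu : Function.Bijective u) (hEis : ∀ φ : Module.Dual O B, ∃ x : B, β x = φ ∘ₗ u) :
    Function.Bijective β := by
  refine ⟨hinj, fun φ ↦ ?_⟩
  let e : B ≃ₗ[O] B := LinearEquiv.ofBijective u hu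
  obtain ⟨x, hx⟩ := hEis (φ ∘ₗ e.symm.toLinearMap)
  refine ⟨x, ?_⟩
  rw [hx]
  ext y
  simp only [LinearMap.coe_comp, Function.comp_apply, LinearEquiv.coe_coe]
  congr 1
  exact e.symm_apply_apply y

end Perfect

end Summit.BirchSwinnertonDyer.BirchSwinnertonDyer.Theorems.LeafPartnerOrders

end
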